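import Summits.ValiantsHypothesis.ValiantsHypothesis.Theorems.DefinabilityGapZperTransferRO
import HarnessLib

/-!
# DefinabilityGap — the `m = 2` column of the width-2 read-once leaf is CLOSED (kernel)

Route `route-ValiantsHypothesis-DefinabilityGap`, read-once leaf F4 / W10 (`KIPlantedHittingRO`,
stmt-ValiantsHypothesis-23704), census cell «decide `ZperHitsRO(2)`».

At `m = 2` the planted generator is `P_c = y_{c(0,0)} y_{c(1,1)} + y_{c(0,1)} y_{c(1,0)}` on the quadratic-curve
design over `𝔽_q`, `q = q(2)`. For EVERY block `c` the three shifted curves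
`e₁ = c + κ₁`, `e₂ = c + κ₁ + κ₃`, `e₃ = c + κ₃` — `κ₁` the coefficient vector of `(X - x₀₀)(X - x₁₁)`,
`κ₃` that of `(X - x₀₁)(X - x₁₀)`, `x_p ∈ 𝔽_q` the abscissa of position `p` — close a 4-cycle of the block
graph: `e₁` shares the diagonal pair of cells with `c` and the anti-diagonal pair with `e₂`, `e₃` shares the
diagonal pair with `e₂` and the anti-diagonal pair with `c`. Hence the LINEAR relation

  `P_c - P_{e₁} + P_{e₂} - P_{e₃} = 0`                                   (`kiPer_two_fourCycle`),

a nonzero width-2 READ-ONCE block chain `(1,0)·[[1,z_c],[0,1]]·[[1,-z_{e₁}],[0,1]]·[[1,z_{e₂}],[0,1]]·[[1,-z_{e₃}],[0,1]]·(0,1)ᵀ`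
(four pairwise distinct blocks, links of degree `1`) annihilated by `φ = bind₁ (kiPer 2)`:

* `exists_roChain_annihilated_two` — width-2 read-once hitting FAILS at `m = 2` (chain currency of
  `DefinabilityGapZperTransferRO.chainVal_eq_zero_of_bind₁_kiPer_ro`);
* `not_zperHitsRO_two` — **`ZperHitsRO(2)` is FALSE** (DECIDES the census sub-cell; the leaf `hZro` of the
  re-based transfer at `m := 2` is refuted through the transfer itself);
* `exists_isROABP_annihilated_two` / `not_roabp_width_two_hits_two` — the same in the matrix currency of
  `KIPlantedHittingRO` (`IsROABP ℂ 2 1 π D`, some order `π`, `N = q³` layers).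

CONSEQUENCE FOR THE LEAF SEARCH: no hypothesis whatsoever can rescue width 2 at `m = 2`; every leaf of the transfer
(`ZperHitsRO`, ratio/normal forms) is false at `m = 2` for the structural reason above, and the honest range of the
read-once width-2 question is `m ≥ 3` (where `DefinabilityGapAffineRung.kiPer_linearIndependent` already excludes
linear annihilators); the open range is `m ≥ 3`. Item 23704 (`KIPlantedHittingRO`, which asks `∃ m ≥ m₀`: an
`∃ m`-range) is untouched by the failure at the single value `m = 2`.
Helper of stmt-23704; 0 S-currency; rung 0; `VP ≠ VNP` untouched.
[cite: KabanetsImpagliazzo2003, Lemma 30] [cite: SahaSaptharishiSaxena2009, Lemma 2.1]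
-/

open MvPolynomial Finset
open scoped Polynomial
open Literature.Computability.AlgebraicComplexity Literature.Computability.MetaComplexity

namespace Summit.ValiantsHypothesis.ValiantsHypothesis.Theorems.DefinabilityGapWidthTwoAtTwo

open DefinabilityGapAffineRung DefinabilityGapZperTransfer DefinabilityGapZperTransferRO

noncomputable section

/-! ## 1. Coordinates on the quadratic-curve design -/

variable {m : ℕ}

/-- The transport `E : Fin q ≃ ZMod q` used by `quadDesign`. [this file] -/
def zE (m : ℕ) : Fin (qOf m) ≃ ZMod (qOf m) :=
  haveI : NeZero (qOf m) := ⟨(qOf_spec m).2.ne_zero⟩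
  (ZMod.finEquiv (qOf m)).toEquiv

/-- The quadratic `ĉ = c₀ + c₁X + c₂X² ∈ 𝔽_q[X]` of the block `c`. [this file] -/
def blkPoly (m : ℕ) (c : Fin 3 → Fin (qOf m)) : (ZMod (qOf m))[X] :=
  Polynomial.ofFn 3 (fun i => zE m (c i))

/-- The abscissa `x_p = E(permPad p) ∈ 𝔽_q` of the permanent position `p`. [this file] -/
def absc (m : ℕ) (p : Fin m × Fin m) : ZMod (qOf m) := zE m (permPad (sq_le_qOf m) p)

/-- The shifted block `c + κ` (coefficientwise in `𝔽_q`). [this file] -/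
def shiftBlk (c : Fin 3 → Fin (qOf m)) (κ : Fin 3 → ZMod (qOf m)) : Fin 3 → Fin (qOf m) :=
  fun i => (zE m).symm (zE m (c i) + κ i)

/-- The coefficient vector of `(X - a)(X - b) = ab - (a+b)X + X²`. [this file] -/
def kap {q : ℕ} (a b : ZMod q) : Fin 3 → ZMod q := ![a * b, -(a + b), 1]

/-- The cell of position `p` in block `c` is `(x_p, ĉ(x_p))` transported back along `E`. [this file] -/
theorem cellEmb_apply (c : Fin 3 → Fin (qOf m)) (p : Fin m × Fin m) :
    cellEmb m c p = ((zE m).symm (absc m p), (zE m).symm ((blkPoly m c).eval (absc m p))) := rfl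

/-- Blocks whose quadratics agree at `x_p` share the cell of position `p`. [this file] -/
theorem cellEmb_eq_of_eval_eq {c e : Fin 3 → Fin (qOf m)} {p : Fin m × Fin m}
    (h : (blkPoly m e).eval (absc m p) = (blkPoly m c).eval (absc m p)) : cellEmb m e p = cellEmb m c p := by
  rw [cellEmb_apply, cellEmb_apply, h]

/-- `absc` is injective. [this file] -/
theorem absc_injective : Function.Injective (absc m) :=
  fun _ _ h => (permPad (sq_le_qOf m)).injective ((zE m).injective h)

/-- The quadratic of a shifted block. [this file] -/
theorem blkPoly_shiftBlk (c : Fin 3 → Fin (qOf m)) (κ : Fin 3 → ZMod (qOf m)) :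
    blkPoly m (shiftBlk c κ) = blkPoly m c + Polynomial.ofFn 3 κ := by
  rw [blkPoly, blkPoly, ← map_add]
  congr 1
  funext i
  simp only [shiftBlk, Equiv.apply_symm_apply, Pi.add_apply]

/-- Evaluating the quadratic of a shifted block. [this file] -/
theorem eval_blkPoly_shiftBlk (c : Fin 3 → Fin (qOf m)) (κ : Fin 3 → ZMod (qOf m)) (x : ZMod (qOf m)) :
    (blkPoly m (shiftBlk c κ)).eval x = (blkPoly m c).eval x + (Polynomial.ofFn 3 κ).eval x := by
  rw [blkPoly_shiftBlk, Polynomial.eval_add]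

/-- Shifting is injective in the shift. [this file] -/
theorem shiftBlk_injective (c : Fin 3 → Fin (qOf m)) : Function.Injective (shiftBlk c) := by
  intro κ κ' h
  funext i
  have hi := congrFun h i
  simp only [shiftBlk, (zE m).symm.injective.eq_iff, add_right_inj] at hi
  exact hi

/-- `c + 0 = c`. [this file] -/
theorem shiftBlk_zero (c : Fin 3 → Fin (qOf m)) : shiftBlk c 0 = c := by
  funext i
  simp only [shiftBlk, Pi.zero_apply, add_zero, Equiv.symm_apply_apply]

/-- The `X²`-coefficient of `κ(a,b)` is `1`. [this file] -/
theorem kap_two {q : ℕ} (a b : ZMod q) : kap a b 2 = 1 := rfl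

/-- `(X - a)(X - b)` evaluated. [this file] -/
theorem eval_ofFn_kap {q : ℕ} (a b x : ZMod q) : (Polynomial.ofFn 3 (kap a b)).eval x = (x - a) * (x - b) := by
  rw [Polynomial.ofFn_eq_sum_monomial, Polynomial.eval_finsetSum, Fin.sum_univ_three]
  simp only [Polynomial.eval_monomial, Fin.val_zero, Fin.val_one, Fin.val_two, pow_zero, pow_one, mul_one,
    show kap a b 0 = a * b from rfl, show kap a b 1 = -(a + b) from rfl, kap_two, one_mul]
  ring

/-! ## 2. The 4-cycle through every block at `m = 2` -/

/-- `P_b = y_{b(0,0)} y_{b(1,1)} + y_{b(0,1)} y_{b(1,0)}` at `m = 2`. [this file] -/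
theorem kiPer_two (b : Fin 3 → Fin (qOf 2)) :
    kiPer 2 b = X (cellEmb 2 b (0, 0)) * X (cellEmb 2 b (1, 1)) + X (cellEmb 2 b (0, 1)) * X (cellEmb 2 b (1, 0)) := by
  rw [kiPer_eq_rename_cellEmb, LangWeilTransfer.ShatteringExclusion.PerTwo.perPoly_fin_two, map_add, map_mul,
    map_mul, rename_X, rename_X, rename_X, rename_X]

/-- **THE 4-CYCLE**: every block `c` at `m = 2` lies on a 4-cycle `c, e₁, e₂, e₃` of pairwise distinct blocks with
`P_c - P_{e₁} + P_{e₂} - P_{e₃} = 0`. [this file] -/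
theorem kiPer_two_fourCycle (c : Fin 3 → Fin (qOf 2)) :
    ∃ e₁ e₂ e₃ : Fin 3 → Fin (qOf 2), [c, e₁, e₂, e₃].Nodup ∧
      kiPer 2 c - kiPer 2 e₁ + kiPer 2 e₂ - kiPer 2 e₃ = 0 := by
  haveI : Fact (Nat.Prime (qOf 2)) := ⟨(qOf_spec 2).2⟩
  -- the two shifts
  set κ₁ : Fin 3 → ZMod (qOf 2) := kap (absc 2 (0, 0)) (absc 2 (1, 1)) with hκ₁_def
  set κ₃ : Fin 3 → ZMod (qOf 2) := kap (absc 2 (0, 1)) (absc 2 (1, 0)) with hκ₃_def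
  have h01 : absc 2 (0, 1) ≠ absc 2 (0, 0) := fun h => absurd (absc_injective h) (by decide)
  have h01' : absc 2 (0, 1) ≠ absc 2 (1, 1) := fun h => absurd (absc_injective h) (by decide)
  have hκ₁ : κ₁ ≠ 0 := fun h => by
    have h2 := congrFun h 2
    rw [hκ₁_def, kap_two, Pi.zero_apply] at h2
    exact one_ne_zero h2
  have hκ₃ : κ₃ ≠ 0 := fun h => by
    have h2 := congrFun h 2
    rw [hκ₃_def, kap_two, Pi.zero_apply] at h2
    exact one_ne_zero h2
  have htwo : (2 : ZMod (qOf 2)) ≠ 0 := by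
    intro h
    have h' : ((2 : ℕ) : ZMod (qOf 2)) = 0 := by exact_mod_cast h
    rw [ZMod.natCast_eq_zero_iff] at h'
    have := Nat.le_of_dvd (by norm_num) h'
    have h5 := (qOf_spec 2).1
    omega
  have hκ₁₃ : κ₁ + κ₃ ≠ 0 := fun h => by
    have h2 := congrFun h 2
    rw [Pi.add_apply, hκ₁_def, hκ₃_def, kap_two, kap_two, Pi.zero_apply, one_add_one_eq_two] at h2
    exact htwo h2
  have hκne : κ₁ ≠ κ₃ := fun h => by
    have h2 := congrArg (fun κ => (Polynomial.ofFn 3 κ).eval (absc 2 (0, 1))) h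
    simp only [hκ₁_def, hκ₃_def, eval_ofFn_kap, sub_self, zero_mul] at h2
    rcases mul_eq_zero.1 h2 with h0 | h0
    · exact h01 (sub_eq_zero.1 h0)
    · exact h01' (sub_eq_zero.1 h0)
  have hinj := shiftBlk_injective c
  have n1 : c ≠ shiftBlk c κ₁ := fun h =>
    hκ₁ (hinj (by rw [shiftBlk_zero]; exact h.symm))
  have n2 : c ≠ shiftBlk c (κ₁ + κ₃) := fun h =>
    hκ₁₃ (hinj (by rw [shiftBlk_zero]; exact h.symm))
  have n3 : c ≠ shiftBlk c κ₃ := fun h =>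
    hκ₃ (hinj (by rw [shiftBlk_zero]; exact h.symm))
  have n4 : shiftBlk c κ₁ ≠ shiftBlk c (κ₁ + κ₃) := fun h =>
    hκ₃ (by simpa using (hinj h).symm)
  have n5 : shiftBlk c κ₁ ≠ shiftBlk c κ₃ := fun h => hκne (hinj h)
  have n6 : shiftBlk c (κ₁ + κ₃) ≠ shiftBlk c κ₃ := fun h =>
    hκ₁ (by simpa using hinj h)
  refine ⟨shiftBlk c κ₁, shiftBlk c (κ₁ + κ₃), shiftBlk c κ₃, ?_, ?_⟩
  · -- pairwise distinct
    refine List.nodup_cons.2 ⟨?_, List.nodup_cons.2 ⟨?_, List.nodup_cons.2 ⟨?_, List.nodup_singleton _⟩⟩⟩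
    · simp only [List.mem_cons, List.not_mem_nil, or_false, not_or]
      exact ⟨n1, n2, n3⟩
    · simp only [List.mem_cons, List.not_mem_nil, or_false, not_or]
      exact ⟨n4, n5⟩
    · simp only [List.mem_singleton]
      exact n6
  · -- the eight shared cells
    have s1 : cellEmb 2 (shiftBlk c κ₁) (0, 0) = cellEmb 2 c (0, 0) := cellEmb_eq_of_eval_eq (by
      rw [eval_blkPoly_shiftBlk, hκ₁_def, eval_ofFn_kap, sub_self, zero_mul, add_zero])
    have s2 : cellEmb 2 (shiftBlk c κ₁) (1, 1) = cellEmb 2 c (1, 1) := cellEmb_eq_of_eval_eq (by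
      rw [eval_blkPoly_shiftBlk, hκ₁_def, eval_ofFn_kap, sub_self, mul_zero, add_zero])
    have s3 : cellEmb 2 (shiftBlk c (κ₁ + κ₃)) (0, 1) = cellEmb 2 (shiftBlk c κ₁) (0, 1) := cellEmb_eq_of_eval_eq (by
      rw [eval_blkPoly_shiftBlk, eval_blkPoly_shiftBlk, map_add, Polynomial.eval_add, hκ₁_def, hκ₃_def,
        eval_ofFn_kap, eval_ofFn_kap, sub_self, zero_mul, add_zero])
    have s4 : cellEmb 2 (shiftBlk c (κ₁ + κ₃)) (1, 0) = cellEmb 2 (shiftBlk c κ₁) (1, 0) := cellEmb_eq_of_eval_eq (by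
      rw [eval_blkPoly_shiftBlk, eval_blkPoly_shiftBlk, map_add, Polynomial.eval_add, hκ₁_def, hκ₃_def,
        eval_ofFn_kap, eval_ofFn_kap, sub_self, mul_zero, add_zero])
    have s5 : cellEmb 2 (shiftBlk c (κ₁ + κ₃)) (0, 0) = cellEmb 2 (shiftBlk c κ₃) (0, 0) := cellEmb_eq_of_eval_eq (by
      rw [eval_blkPoly_shiftBlk, eval_blkPoly_shiftBlk, map_add, Polynomial.eval_add, hκ₁_def, hκ₃_def,
        eval_ofFn_kap, eval_ofFn_kap, sub_self, zero_mul, zero_add])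
    have s6 : cellEmb 2 (shiftBlk c (κ₁ + κ₃)) (1, 1) = cellEmb 2 (shiftBlk c κ₃) (1, 1) := cellEmb_eq_of_eval_eq (by
      rw [eval_blkPoly_shiftBlk, eval_blkPoly_shiftBlk, map_add, Polynomial.eval_add, hκ₁_def, hκ₃_def,
        eval_ofFn_kap, eval_ofFn_kap, sub_self, mul_zero, zero_add])
    have s7 : cellEmb 2 (shiftBlk c κ₃) (0, 1) = cellEmb 2 c (0, 1) := cellEmb_eq_of_eval_eq (by
      rw [eval_blkPoly_shiftBlk, hκ₃_def, eval_ofFn_kap, sub_self, zero_mul, add_zero])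
    have s8 : cellEmb 2 (shiftBlk c κ₃) (1, 0) = cellEmb 2 c (1, 0) := cellEmb_eq_of_eval_eq (by
      rw [eval_blkPoly_shiftBlk, hκ₃_def, eval_ofFn_kap, sub_self, mul_zero, add_zero])
    rw [kiPer_two, kiPer_two, kiPer_two, kiPer_two, s1, s2, s3, s4, s5, s6, s7, s8]
    ring

/-! ## 3. Width-2 read-once hitting fails at `m = 2` -/

/-- The unipotent link `[[1, s·X],[0,1]]` on the block `b`. [this file] -/
def upLink (b : Fin 3 → Fin (qOf 2)) (s : ℂ) : W2Link 2 := ⟨b, !![1, Polynomial.C s * Polynomial.X; 0, 1]⟩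

/-- Its link matrix is `[[1, s·z_b],[0,1]]`. [this file] -/
theorem mat_upLink (b : Fin 3 → Fin (qOf 2)) (s : ℂ) :
    (upLink b s).mat = !![1, C s * X b; 0, 1] := by
  ext i j
  fin_cases i <;> fin_cases j <;>
    simp [upLink, W2Link.mat, ulink, Matrix.map_apply, Polynomial.aeval_C, MvPolynomial.algebraMap_eq]

/-- Products of unipotent upper-triangular `2 × 2` matrices add their corners. [folklore] -/
theorem prod_map_unipotent {R : Type*} [CommSemiring R] (xs : List R) :
    (xs.map fun x => !![(1 : R), x; 0, 1]).prod = !![1, xs.sum; 0, 1] := by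
  induction xs with
  | nil => rw [List.map_nil, List.prod_nil, List.sum_nil, Matrix.one_fin_two]
  | cons x xs ih =>
    rw [List.map_cons, List.prod_cons, ih, List.sum_cons]
    ext i j
    fin_cases i <;> fin_cases j <;> simp [Matrix.mul_apply, Fin.sum_univ_two, add_comm]

/-- The value `(1,0)·∏[[1,xᵢ],[0,1]]·(0,1)ᵀ = Σ xᵢ`. [folklore] -/
theorem chainVal_map_unipotent {σ R : Type*} [CommSemiring R] (xs : List (MvPolynomial σ R)) :
    chainVal (xs.map fun x => !![(1 : MvPolynomial σ R), x; 0, 1]) ![1, 0] ![0, 1] = xs.sum := by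
  rw [chainVal, prod_map_unipotent]
  simp [Matrix.mulVec, dotProduct, Fin.sum_univ_two]

/-- **WIDTH-2 READ-ONCE HITTING FAILS AT `m = 2`**: a width-2 read-once block chain on four pairwise distinct blocks
(links of degree `1`) with nonzero value annihilated by `φ = bind₁ (kiPer 2)`. [this file] -/
theorem exists_roChain_annihilated_two :
    ∃ l : List (W2Link 2), (l.map W2Link.blk).Nodup ∧
      chainVal (l.map W2Link.mat) ![1, 0] ![0, 1] ≠ 0 ∧
      bind₁ (kiPer 2) (chainVal (l.map W2Link.mat) ![1, 0] ![0, 1]) = 0 := by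
  set c : Fin 3 → Fin (qOf 2) := fun _ => ⟨0, (qOf_spec 2).2.pos⟩ with hc_def
  obtain ⟨e₁, e₂, e₃, hnd, hrel⟩ := kiPer_two_fourCycle c
  refine ⟨[upLink c 1, upLink e₁ (-1), upLink e₂ 1, upLink e₃ (-1)], by simpa [upLink] using hnd, ?_⟩
  have hval : chainVal ([upLink c 1, upLink e₁ (-1), upLink e₂ 1, upLink e₃ (-1)].map W2Link.mat) ![1, 0] ![0, 1] =
      X c - X e₁ + X e₂ - X e₃ := by
    have hl : [upLink c 1, upLink e₁ (-1), upLink e₂ 1, upLink e₃ (-1)].map W2Link.mat =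
        [C 1 * X c, C (-1) * X e₁, C 1 * X e₂, C (-1) * X e₃].map fun x => !![(1 : MvPolynomial _ ℂ), x; 0, 1] := by
      simp only [List.map_cons, List.map_nil, mat_upLink]
    rw [hl, chainVal_map_unipotent]
    simp only [List.sum_cons, List.sum_nil, map_one, one_mul, map_neg, neg_mul, add_zero]
    ring
  rw [hval]
  have hc' : c ∉ [e₁, e₂, e₃] := (List.nodup_cons.1 hnd).1
  have h1 : e₁ ≠ c := fun h => hc' (by simp [h])
  have h2 : e₂ ≠ c := fun h => hc' (by simp [h])
  have h3 : e₃ ≠ c := fun h => hc' (by simp [h])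
  refine ⟨fun h => ?_, ?_⟩
  · have hc := congrArg (coeff (Finsupp.single c 1)) h
    simp [coeff_X, Finsupp.single_left_inj (one_ne_zero : (1 : ℕ) ≠ 0), h1, h2, h3] at hc
  · simp only [map_sub, map_add, bind₁_X_right]
    exact hrel

/-- The conclusion of the read-once transfer fails at `m = 2`. [this file] -/
theorem not_roChain_hits_two : ¬ ∀ l : List (W2Link 2), (l.map W2Link.blk).Nodup → ∀ u v : Fin 2 → ℂ,
      bind₁ (kiPer 2) (chainVal (l.map W2Link.mat) u v) = 0 → chainVal (l.map W2Link.mat) u v = 0 := by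
  intro h
  obtain ⟨l, hnd, hne, h0⟩ := exists_roChain_annihilated_two
  exact hne (h l hnd _ _ h0)

/-- **`ZperHitsRO(2)` IS FALSE** (census cell «decide `ZperHitsRO(2)`»): the leaf `hZro` of
`DefinabilityGapZperTransferRO.chainVal_eq_zero_of_bind₁_kiPer_ro` fails at `m = 2`, because its consequence
(width-2 read-once hitting) does. [this file] -/
theorem not_zperHitsRO_two : ¬ ∀ (c : Fin 3 → Fin (qOf 2)) (rest : List (W2Link 2)),
      (rest.map W2Link.blk).Nodup → c ∉ rest.map W2Link.blk →
      ∀ (u v : Fin 2 → ℂ) (H : MvPolynomial (Fin 2 × Fin 2) (Kfrac 2)),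
        chainVal ((pushLinks 2 c rest).map ulink) (fun i => toKfrac 2 (u i)) (fun k => toKfrac 2 (v k)) =
            perPoly (Fin 2) (Kfrac 2) * H →
          chainVal ((pushLinks 2 c rest).map ulink) (fun i => toKfrac 2 (u i)) (fun k => toKfrac 2 (v k)) = 0 :=
  fun hZro => not_roChain_hits_two (chainVal_eq_zero_of_bind₁_kiPer_ro hZro)

/-! ## 4. The same in the matrix currency of `KIPlantedHittingRO` -/

/-- Products of unipotent lower-triangular `2 × 2` matrices add their corners. [folklore] -/
theorem prod_map_lower {R : Type*} [CommSemiring R] (xs : List R) :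
    (xs.map fun x => !![(1 : R), 0; x, 1]).prod = !![1, 0; xs.sum, 1] := by
  induction xs with
  | nil => rw [List.map_nil, List.prod_nil, List.sum_nil, Matrix.one_fin_two]
  | cons x xs ih =>
    rw [List.map_cons, List.prod_cons, ih, List.sum_cons]
    ext i j
    fin_cases i <;> fin_cases j <;> simp [Matrix.mul_apply, Fin.sum_univ_two, add_comm]

/-- `Σ_b [b = c] z_b = z_c`. [folklore] -/
theorem sum_C_single_mul_X {ι : Type*} [Fintype ι] [DecidableEq ι] (c : ι) :
    ∑ b, C ((Pi.single c (1 : ℂ) : ι → ℂ) b) * (X b : MvPolynomial ι ℂ) = X c := by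
  rw [Finset.sum_eq_single c (fun b _ hb => by rw [Pi.single_eq_of_ne hb, C_0, zero_mul])
    (fun h => absurd (Finset.mem_univ c) h), Pi.single_eq_same, C_1, one_mul]

/-- **A LINEAR FORM IS A WIDTH-2 ROABP OF INDIVIDUAL DEGREE `1` IN EVERY ORDER** with `N = |ι|` layers:
`Σ_b a_b z_b = ([[a_{π0} z_{π0}, 1],[0,0]] · ∏_{i ≥ 1} [[1,0],[a_{πi} z_{πi}, 1]])₀₀`. [folklore] -/
theorem isROABP_linearForm {ι : Type*} [Fintype ι] [DecidableEq ι] {N' : ℕ} (π : Fin (N' + 1) ≃ ι) (a : ι → ℂ) :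
    IsROABP ℂ 2 1 π (∑ b, C (a b) * (X b : MvPolynomial ι ℂ)) := by
  let M : Fin (N' + 1) → Matrix (Fin 2) (Fin 2) (MvPolynomial ι ℂ) := fun i =>
    if i = 0 then !![C (a (π i)) * X (π i), 1; 0, 0] else !![1, 0; C (a (π i)) * X (π i), 1]
  have hM0 : ∀ i, i = 0 → M i = !![C (a (π i)) * X (π i), 1; 0, 0] := fun i hi => by simp only [M, if_pos hi]
  have hM1 : ∀ i, i ≠ 0 → M i = !![1, 0; C (a (π i)) * X (π i), 1] := fun i hi => by simp only [M, if_neg hi]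
  have hdeg : ∀ b, (Polynomial.C (a b) * Polynomial.X : ℂ[X]).natDegree ≤ 1 := fun b =>
    (Polynomial.natDegree_C_mul_le _ _).trans Polynomial.natDegree_X_le
  refine ⟨by norm_num, M, fun i j k => ?_, ?_⟩
  · by_cases hi : i = 0
    · rw [hM0 i hi]
      fin_cases j <;> fin_cases k
      · exact ⟨_, hdeg (π i), by simp⟩
      · exact ⟨1, by simp, by simp⟩
      · exact ⟨0, by simp, by simp⟩
      · exact ⟨0, by simp, by simp⟩
    · rw [hM1 i hi]
      fin_cases j <;> fin_cases k
      · exact ⟨1, by simp, by simp⟩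
      · exact ⟨0, by simp, by simp⟩
      · exact ⟨_, hdeg (π i), by simp⟩
      · exact ⟨1, by simp, by simp⟩
  · have htail : (List.ofFn fun i : Fin N' => M i.succ) =
        (List.ofFn fun i : Fin N' => C (a (π i.succ)) * (X (π i.succ) : MvPolynomial ι ℂ)).map
          fun x => !![(1 : MvPolynomial ι ℂ), 0; x, 1] := by
      rw [List.map_ofFn]
      exact congrArg List.ofFn (funext fun i => hM1 _ (Fin.succ_ne_zero i))
    rw [List.ofFn_succ, List.prod_cons, htail, prod_map_lower, List.sum_ofFn, hM0 0 rfl,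
      ← Equiv.sum_comp π (fun b => C (a b) * (X b : MvPolynomial ι ℂ)), Fin.sum_univ_succ]
    simp [Matrix.mul_apply, Fin.sum_univ_two]

/-- **A NONZERO WIDTH-2 ROABP OF INDIVIDUAL DEGREE `1` ANNIHILATED BY `G₂`** (matrix currency of
`KIPlantedHittingRO`: `IsROABP ℂ 2 1 π D`, `N = q³` layers). [this file] -/
theorem exists_isROABP_annihilated_two :
    ∃ (N : ℕ) (π : Fin N ≃ (Fin 3 → Fin (qOf 2))) (D : MvPolynomial (Fin 3 → Fin (qOf 2)) ℂ),
      D ≠ 0 ∧ IsROABP ℂ 2 1 π D ∧ bind₁ (kiPer 2) D = 0 := by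
  classical
  set c : Fin 3 → Fin (qOf 2) := fun _ => ⟨0, (qOf_spec 2).2.pos⟩ with hc_def
  obtain ⟨e₁, e₂, e₃, hnd, hrel⟩ := kiPer_two_fourCycle c
  have hc' : c ∉ [e₁, e₂, e₃] := (List.nodup_cons.1 hnd).1
  have h1 : e₁ ≠ c := fun h => hc' (by simp [h])
  have h2 : e₂ ≠ c := fun h => hc' (by simp [h])
  have h3 : e₃ ≠ c := fun h => hc' (by simp [h])
  obtain ⟨N', hN'⟩ : ∃ N', Fintype.card (Fin 3 → Fin (qOf 2)) = N' + 1 :=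
    ⟨Fintype.card (Fin 3 → Fin (qOf 2)) - 1, by
      have : 0 < Fintype.card (Fin 3 → Fin (qOf 2)) := Fintype.card_pos_iff.2 ⟨c⟩
      omega⟩
  let π : Fin (N' + 1) ≃ (Fin 3 → Fin (qOf 2)) :=
    (finCongr hN'.symm).trans (Fintype.equivFin (Fin 3 → Fin (qOf 2))).symm
  set a : (Fin 3 → Fin (qOf 2)) → ℂ := Pi.single c 1 - Pi.single e₁ 1 + Pi.single e₂ 1 - Pi.single e₃ 1 with ha
  have hD : ∑ b, C (a b) * (X b : MvPolynomial (Fin 3 → Fin (qOf 2)) ℂ) = X c - X e₁ + X e₂ - X e₃ := by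
    simp only [ha, Pi.sub_apply, Pi.add_apply, map_sub, map_add, sub_mul, add_mul, Finset.sum_sub_distrib,
      Finset.sum_add_distrib, sum_C_single_mul_X]
  refine ⟨N' + 1, π, _, ?_, isROABP_linearForm π a, ?_⟩
  · rw [hD]
    intro h
    have hc := congrArg (coeff (Finsupp.single c 1)) h
    simp [coeff_X, Finsupp.single_left_inj (one_ne_zero : (1 : ℕ) ≠ 0), h1, h2, h3] at hc
  · rw [hD]
    simp only [map_sub, map_add, bind₁_X_right]
    exact hrel

/-- **Width-2 ROABP hitting (every order, individual degree `1`) FAILS at `m = 2`** — the conclusion of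
`DefinabilityGapZperTransferRO.kiPer_hits_isROABP_two_ro` at `m := 2` is false, hence so is every leaf feeding it.
[this file] -/
theorem not_roabp_width_two_hits_two : ¬ ∀ (N d : ℕ) (π : Fin N ≃ (Fin 3 → Fin (qOf 2)))
      (D : MvPolynomial (Fin 3 → Fin (qOf 2)) ℂ), D ≠ 0 → IsROABP ℂ 2 d π D → bind₁ (kiPer 2) D ≠ 0 := by
  intro h
  obtain ⟨N, π, D, hD, hR, h0⟩ := exists_isROABP_annihilated_two
  exact h N 1 π D hD hR h0

end

end Summit.ValiantsHypothesis.ValiantsHypothesis.Theorems.DefinabilityGapWidthTwoAtTwo
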